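import Mathlib
import Summits.NavierStokesRegularity.NavierStokesRegularity.Theorems.TaoLadderRungTwoFlatCaptureContinuity
import HarnessLib

/-!
# DEEP BEHIND THE FRONT THE PLAIN AMPLITUDES OF AN EXACT GRADED FLOW ARE FROZEN (K4, the behind a-priori bound in the PLAIN sup norm):
  a localised bound of the graded nonlinearity and a continuous induction over the infinitely many deep shells
  (helper for the K_A♭ parent item stmt-NavierStokesRegularity-22987 `FlatGapCertificatesV2`, child 2A `GradedAdiabaticWakeA` of route
  TaoLadderRungTwoFlat; cell harvest/h2-tao-ladder, p1 g25; LADDER §47.5 L2, §50 (`TubeExist`, K4), §54 (behind zone))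

The format's existence clause (`TubeExistWith`, reduced to an a-priori weighted bound by `tubeExistWith_of_apriori`) needs a PLAIN sup bound of
the flow behind the window (an admissible Banach weight is bounded below there: (4.5) caps plain amplitudes). The in-hop behind loops deliver
CLOCK-weighted amplitudes `c_k|S_k| ≤ A_eff` (block energies), which allow plain amplitudes `A_eff/c_k → ∞` with depth. The missing
ingredient is elementary: on a nearest-neighbour shift set the graded nonlinearity at shell `n` reads only shells `n−1, n, n+1` and carries
the clock `(1+ε₀)^{5(n−μ₃)/2} ≤ c_n`, so `|Ṡ_n| ≤ c_n·‖α‖₁·(max_{|j−n|≤1}|S_j|)²` (`abs_quadTermOn_le_local`); deep behind `c_n → 0`, and a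
continuous induction on the predicate "all shells `≤ k⋆` stay below `2Λ₁` so far" (closed by continuity of each amplitude; right-open by the
uniform Lipschitz bound that (4.5) provides) shows the plain amplitudes below `k⋆` move by at most `Λ₁/2` over the window when
`8τ‖α‖₁c_{k⋆}Λ₁ ≤ 1`, given ONE boundary shell `k⋆+1` plain-bounded by `2Λ₁` (from the block energies at moderate depth).

* `abs_quadTermOn_le_local` — `|quadTermOn 𝕊 ε₀ α S i n t| ≤ c_n·tableAbsSum 𝕊 α·M²` from `|S_j(n−1..n+1)| ≤ M` (nearest-neighbour `𝕊`, `0 ≤ ε₀`);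
* `exists_clockW_le` — `∀ δ > 0, ∃ k⋆ ≤ 0, c_{k⋆} ≤ δ` (`0 < ε₀`);
* `deepBehind_plain_sup` — **for an exact graded flow on `[0, τ]`: `|S₀| ≤ Λ₁` on `k ≤ k⋆`, `|S_{k⋆+1}| ≤ 2Λ₁` on the window,
  `8τ‖α‖₁c_{k⋆}Λ₁ ≤ 1` ⇒ `|S_{ik}(t)| ≤ 2Λ₁` for all `k ≤ k⋆`, `t ∈ [0, τ]`.**

HONEST FRAMING: elementary real analysis about MODEL-lattice flows (any table on a nearest-neighbour shift set); all levels are HYPOTHESES;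
nothing certified; no item closed; nothing about the Navier–Stokes equations.
-/

noncomputable section

-- the sub-problem namespace repeats the summit name by design (D-0017)
set_option linter.dupNamespace false

namespace Summit.NavierStokesRegularity.NavierStokesRegularity.Theorems.HopTube

open Set Finset Filter Topology Literature.Analysis.FluidPDE Literature.Analysis.FluidPDE.TaoCascade MirrorPulse RenormFrame QuadPolar
  GappedFrontRobustOn

/-- **Localised bound of the graded nonlinearity** on a nearest-neighbour shift set: shell `n` reads shells `n−1, n, n+1` only, with clock
`(1+ε₀)^{5(n−μ₃)/2} ≤ c_n`; so `|S_j(m)| ≤ M` for `m ∈ [n−1, n+1]` gives `|quadTermOn 𝕊 ε₀ α S i n t| ≤ c_n·‖α‖₁·M²`.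
[cite: Tao2016AveragedNS, §4 (4.8) (the nonlinearity and its clocks); cell LADDER §54 (behind zone)] -/
theorem abs_quadTermOn_le_local {m : ℕ} {𝕊 : Finset (ℤ × ℤ × ℤ)} (h𝕊 : IsNearestNeighbourSet 𝕊) {ε₀ : ℝ} (hε₀ : 0 ≤ ε₀)
    (α : Fin m → Fin m → Fin m → ℤ × ℤ × ℤ → ℝ) {S : Fin m → ℤ → ℝ → ℝ} {M : ℝ} {n : ℤ} {t : ℝ} (hM : 0 ≤ M)
    (hS : ∀ (j : Fin m) (k : ℤ), n - 1 ≤ k → k ≤ n + 1 → |S j k t| ≤ M) (i : Fin m) :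
    |quadTermOn 𝕊 ε₀ α S i n t| ≤ clockW ε₀ n * tableAbsSum 𝕊 α * M ^ 2 := by
  have h1ε : (1 : ℝ) ≤ 1 + ε₀ := by linarith
  have hc0 : 0 ≤ clockW ε₀ n := (clockW_pos (by linarith) n).le
  unfold quadTermOn
  -- term-wise bound
  have hterm : ∀ (i₁ i₂ : Fin m), ∀ μ ∈ 𝕊,
      |α i₁ i₂ i μ * (1 + ε₀) ^ ((5 : ℝ) * (n - μ.2.2) / 2) * (S i₁ (n - μ.2.2 + μ.1) t * S i₂ (n - μ.2.2 + μ.2.1) t)|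
        ≤ |α i₁ i₂ i μ| * (clockW ε₀ n * M ^ 2) := by
    intro i₁ i₂ μ hμ
    obtain ⟨h1, h2, h3⟩ := h𝕊 μ hμ
    have hclock : (1 + ε₀) ^ ((5 : ℝ) * (n - μ.2.2) / 2) ≤ clockW ε₀ n := by
      unfold clockW
      apply Real.rpow_le_rpow_of_exponent_le h1ε
      rcases h3 with h | h
      · simp [h]
      · simp [h]; linarith
    have hcl0 : 0 ≤ (1 + ε₀) ^ ((5 : ℝ) * (n - μ.2.2) / 2) := Real.rpow_nonneg (by linarith) _
    have ha : |S i₁ (n - μ.2.2 + μ.1) t| ≤ M := hS _ _ (by rcases h1 with h | h <;> rcases h3 with h' | h' <;> omega)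
      (by rcases h1 with h | h <;> rcases h3 with h' | h' <;> omega)
    have hb : |S i₂ (n - μ.2.2 + μ.2.1) t| ≤ M := hS _ _ (by rcases h2 with h | h <;> rcases h3 with h' | h' <;> omega)
      (by rcases h2 with h | h <;> rcases h3 with h' | h' <;> omega)
    rw [abs_mul, abs_mul, abs_mul, abs_of_nonneg hcl0]
    have hprod : |S i₁ (n - μ.2.2 + μ.1) t| * |S i₂ (n - μ.2.2 + μ.2.1) t| ≤ M * M :=
      mul_le_mul ha hb (abs_nonneg _) hM
    calc |α i₁ i₂ i μ| * (1 + ε₀) ^ ((5 : ℝ) * (n - μ.2.2) / 2) * (|S i₁ (n - μ.2.2 + μ.1) t| * |S i₂ (n - μ.2.2 + μ.2.1) t|)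
        ≤ |α i₁ i₂ i μ| * clockW ε₀ n * (M * M) :=
          mul_le_mul (mul_le_mul_of_nonneg_left hclock (abs_nonneg _)) hprod (by positivity) (by positivity)
      _ = |α i₁ i₂ i μ| * (clockW ε₀ n * M ^ 2) := by ring
  calc |∑ i₁ : Fin m, ∑ i₂ : Fin m, ∑ μ ∈ 𝕊,
          α i₁ i₂ i μ * (1 + ε₀) ^ ((5 : ℝ) * (n - μ.2.2) / 2) * (S i₁ (n - μ.2.2 + μ.1) t * S i₂ (n - μ.2.2 + μ.2.1) t)|
      ≤ ∑ i₁ : Fin m, ∑ i₂ : Fin m, ∑ μ ∈ 𝕊,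
          |α i₁ i₂ i μ * (1 + ε₀) ^ ((5 : ℝ) * (n - μ.2.2) / 2) * (S i₁ (n - μ.2.2 + μ.1) t * S i₂ (n - μ.2.2 + μ.2.1) t)| := by
        refine (Finset.abs_sum_le_sum_abs _ _).trans (Finset.sum_le_sum fun i₁ _ => ?_)
        refine (Finset.abs_sum_le_sum_abs _ _).trans (Finset.sum_le_sum fun i₂ _ => ?_)
        exact Finset.abs_sum_le_sum_abs _ _
    _ ≤ ∑ i₁ : Fin m, ∑ i₂ : Fin m, ∑ μ ∈ 𝕊, |α i₁ i₂ i μ| * (clockW ε₀ n * M ^ 2) :=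
        Finset.sum_le_sum fun i₁ _ => Finset.sum_le_sum fun i₂ _ => Finset.sum_le_sum fun μ hμ => hterm i₁ i₂ μ hμ
    _ = (∑ i₁ : Fin m, ∑ i₂ : Fin m, ∑ μ ∈ 𝕊, |α i₁ i₂ i μ|) * (clockW ε₀ n * M ^ 2) := by
        simp only [Finset.sum_mul]
    _ ≤ tableAbsSum 𝕊 α * (clockW ε₀ n * M ^ 2) := by
        apply mul_le_mul_of_nonneg_right _ (by positivity)
        unfold tableAbsSum
        have : ∀ j : Fin m, 0 ≤ ∑ i₁ : Fin m, ∑ i₂ : Fin m, ∑ μ ∈ 𝕊, |α i₁ i₂ j μ| := fun j => by positivity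
        exact Finset.single_le_sum (f := fun j => ∑ i₁ : Fin m, ∑ i₂ : Fin m, ∑ μ ∈ 𝕊, |α i₁ i₂ j μ|)
          (fun j _ => this j) (Finset.mem_univ i)
    _ = clockW ε₀ n * tableAbsSum 𝕊 α * M ^ 2 := by ring

/-- **The clocks vanish behind**: for `0 < ε₀` and `δ > 0` there is `k⋆ ≤ 0` with `c_{k⋆} ≤ δ` (hence `c_k ≤ δ` for all `k ≤ k⋆`).
[cite: Tao2016AveragedNS, §4 (4.8) (clocks); folklore (Bernoulli)] -/
theorem exists_clockW_le {ε₀ δ : ℝ} (hε₀ : 0 < ε₀) (hδ : 0 < δ) : ∃ kstar : ℤ, kstar ≤ 0 ∧ clockW ε₀ kstar ≤ δ := by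
  obtain ⟨N, hN⟩ := exists_nat_gt (1 / (δ * ε₀))
  refine ⟨-(N : ℤ), by omega, ?_⟩
  have hq : 0 < 1 + ε₀ := by linarith
  have h3 : clockW ε₀ (-(N : ℤ)) ≤ (1 + ε₀) ^ (-(N : ℝ)) := by
    unfold clockW
    exact Real.rpow_le_rpow_of_exponent_le (by linarith) (by push_cast; nlinarith [Nat.cast_nonneg (α := ℝ) N])
  have hbern : 1 + (N : ℝ) * ε₀ ≤ (1 + ε₀) ^ (N : ℝ) := by
    have := one_add_mul_le_pow (by linarith : (-2 : ℝ) ≤ ε₀) N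
    rw [Real.rpow_natCast]; linarith
  have hpos : 0 < 1 + (N : ℝ) * ε₀ := by positivity
  have h4 : (1 + ε₀) ^ (-(N : ℝ)) ≤ (1 + (N : ℝ) * ε₀)⁻¹ := by
    rw [Real.rpow_neg hq.le]; exact inv_anti₀ hpos hbern
  have h5 : (1 + (N : ℝ) * ε₀)⁻¹ ≤ δ := by
    rw [inv_le_iff_one_le_mul₀ hpos]
    have h7 : 1 / (δ * ε₀) < N := hN
    rw [div_lt_iff₀ (by positivity)] at h7
    nlinarith
  exact h3.trans (h4.trans h5)

/-- Clocks are monotone in the shell. [cite: Tao2016AveragedNS, §4 (4.8)] -/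
theorem clockW_mono {ε₀ : ℝ} (hε₀ : 0 ≤ ε₀) {k k' : ℤ} (h : k ≤ k') : clockW ε₀ k ≤ clockW ε₀ k' := by
  unfold clockW
  have : (k : ℝ) ≤ k' := by exact_mod_cast h
  exact Real.rpow_le_rpow_of_exponent_le (by linarith) (by linarith)

/-- **DEEP BEHIND, THE PLAIN AMPLITUDES ARE FROZEN.** An exact graded flow `S` on `[0, τ]` (nearest-neighbour `𝕊`, `0 < ε₀`) with
`|S₀_{ik}| ≤ Λ₁` for `k ≤ k⋆`, the boundary shell `|S_{i,k⋆+1}(t)| ≤ 2Λ₁` on the window, and `8τ·‖α‖₁·c_{k⋆}·Λ₁ ≤ 1` keeps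
`|S_{ik}(t)| ≤ 2Λ₁` for every `k ≤ k⋆` and `t ∈ [0, τ]` (indeed within `Λ₁/2` of its start value).
[cite: Tao2016AveragedNS, §4 Lemma 4.1 (4.5), (4.8), §5 (continuity argument); route TaoLadderRungTwoFlat, K4 (cell LADDER §47.5 L2, §54)] -/
theorem deepBehind_plain_sup {m : ℕ} {𝕊 : Finset (ℤ × ℤ × ℤ)} (h𝕊 : IsNearestNeighbourSet 𝕊) {τ ε₀ : ℝ}
    {α : Fin m → Fin m → Fin m → ℤ × ℤ × ℤ → ℝ} {κ₂ : ℝ} {S₀ F₀ B₀ : Fin m → ℤ → ℝ} {S F : Fin m → ℤ → ℝ → ℝ}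
    (hS : PseudoFlowOnShift 𝕊 τ ε₀ α 0 κ₂ S₀ F₀ B₀ S F) (hε₀ : 0 < ε₀)
    {kstar : ℤ} {Λ₁ : ℝ} (hΛ₁ : 0 < Λ₁)
    (h0 : ∀ (i : Fin m) (k : ℤ), k ≤ kstar → |S₀ i k| ≤ Λ₁)
    (hb : ∀ (i : Fin m), ∀ t ∈ Icc 0 τ, |S i (kstar + 1) t| ≤ 2 * Λ₁)
    (hsmall : 8 * τ * tableAbsSum 𝕊 α * clockW ε₀ kstar * Λ₁ ≤ 1) :
    ∀ (i : Fin m) (k : ℤ), k ≤ kstar → ∀ t ∈ Icc 0 τ, |S i k t| ≤ 2 * Λ₁ := by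
  have hε' : (-1 : ℝ) < ε₀ := by linarith
  have hc : ∀ k, 0 < clockW ε₀ k := clockW_pos hε'
  have hT0 : 0 ≤ tableAbsSum 𝕊 α := tableAbsSum_nonneg _ _
  have hScont : ∀ i k, ContinuousOn (S i k) (Icc 0 τ) := fun i k => continuousOn_of_pseudoFlowOnShift hS i k
  have hSder : ∀ i k, ∀ u ∈ Ioo 0 τ, HasDerivAt (S i k) (quadTermOn 𝕊 ε₀ α S i k u) u :=
    fun i k u hu => hasDerivAt_of_pseudoFlowOnShift_exact hS i k hu
  -- the qualitative uniform Lipschitz bound from (4.5)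
  obtain ⟨M', hM'⟩ := hS.apriori_S
  have hMabs : ∀ u ∈ Icc 0 τ, ∀ (j : Fin m) (k : ℤ), |S j k u| ≤ M' := by
    intro u hu j k
    have h := hM' u hu j k
    have hp : 0 ≤ (1 + ε₀) ^ ((10 : ℝ) * k) := Real.rpow_nonneg (by linarith) _
    nlinarith [abs_nonneg (S j k u)]
  set M'' : ℝ := max M' 0 with hM''
  have hM''0 : 0 ≤ M'' := le_max_right _ _
  have hMabs' : ∀ u ∈ Icc 0 τ, ∀ (j : Fin m) (k : ℤ), |S j k u| ≤ M'' := fun u hu j k => (hMabs u hu j k).trans (le_max_left _ _)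
  -- slope bound: on an interval inside `[0, τ]` where all shells `≤ k⋆ + 1` are `≤ B` at every interior time, shell `k ≤ k⋆` moves by
  -- at most `c_{k⋆}·‖α‖₁·B²·(length)`
  have hslope : ∀ (i : Fin m) (k : ℤ), k ≤ kstar → ∀ (a b B : ℝ), 0 ≤ a → a < b → b ≤ τ → 0 ≤ B →
      (∀ u ∈ Ioo a b, ∀ (j : Fin m) (k' : ℤ), k' ≤ kstar + 1 → |S j k' u| ≤ B) →
        |S i k b - S i k a| ≤ clockW ε₀ kstar * tableAbsSum 𝕊 α * B ^ 2 * (b - a) := by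
    intro i k hk a b B ha hab hbτ hB hloc
    obtain ⟨ξ, hξ, hslopeEq⟩ := exists_hasDerivAt_eq_slope (S i k) (fun u => quadTermOn 𝕊 ε₀ α S i k u) hab
      ((hScont i k).mono (Icc_subset_Icc ha hbτ)) (fun u hu => hSder i k u ⟨ha.trans_lt hu.1, hu.2.trans_le hbτ⟩)
    have hQ : |quadTermOn 𝕊 ε₀ α S i k ξ| ≤ clockW ε₀ k * tableAbsSum 𝕊 α * B ^ 2 :=
      abs_quadTermOn_le_local h𝕊 hε₀.le α hB (fun j k' _ hk' => hloc ξ hξ j k' (by omega)) i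
    have hQ' : |quadTermOn 𝕊 ε₀ α S i k ξ| ≤ clockW ε₀ kstar * tableAbsSum 𝕊 α * B ^ 2 :=
      hQ.trans (mul_le_mul_of_nonneg_right (mul_le_mul_of_nonneg_right (clockW_mono hε₀.le hk) hT0) (sq_nonneg _))
    have hba : 0 < b - a := sub_pos.mpr hab
    have e : S i k b - S i k a = quadTermOn 𝕊 ε₀ α S i k ξ * (b - a) := by
      rw [hslopeEq]; field_simp
    rw [e, abs_mul, abs_of_pos hba]
    exact mul_le_mul_of_nonneg_right hQ' hba.le
  -- the history set
  set H : Set ℝ := {t | ∀ s ∈ Icc 0 τ, ∀ (i : Fin m) (k : ℤ), k ≤ kstar → |S i k (min s t)| ≤ 2 * Λ₁} with hH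
  have hmain : Icc 0 τ ⊆ H := by
    apply IsClosed.Icc_subset_of_forall_mem_nhdsWithin
    · -- closedness of `H ∩ [0, τ]`
      have hrepr : H ∩ Icc 0 τ = Icc 0 τ ∩
          ⋂ s ∈ Icc 0 τ, ⋂ i : Fin m, ⋂ k : {k : ℤ // k ≤ kstar}, (Icc 0 τ ∩ (fun t => |S i k.1 (min s t)|) ⁻¹' Iic (2 * Λ₁)) := by
        ext t
        simp only [hH, mem_inter_iff, mem_setOf_eq, mem_iInter, Set.mem_preimage, Set.mem_Iic, Subtype.forall]
        constructor
        · rintro ⟨h1, h2⟩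
          exact ⟨h2, fun s hs i k hk => ⟨h2, h1 s hs i k hk⟩⟩
        · rintro ⟨h2, h⟩
          exact ⟨fun s hs i k hk => (h s hs i k hk).2, h2⟩
      rw [hrepr]
      refine isClosed_Icc.inter (isClosed_biInter fun s hs => isClosed_iInter fun i => isClosed_iInter fun k => ?_)
      have hcont : ContinuousOn (fun t => |S i k.1 (min s t)|) (Icc 0 τ) := by
        refine ((hScont i k.1).comp (continuous_const.min continuous_id).continuousOn ?_).abs
        intro t ht
        exact ⟨le_min hs.1 ht.1, (min_le_right s t).trans ht.2⟩
      exact hcont.preimage_isClosed_of_isClosed isClosed_Icc isClosed_Iic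
    · -- `0 ∈ H`
      intro s hs i k hk
      rw [min_eq_right hs.1, hS.init_S]
      linarith [h0 i k hk]
    · -- right-openness
      rintro x ⟨hxH, hx⟩
      have hist : ∀ s ∈ Icc 0 x, ∀ (i : Fin m) (k : ℤ), k ≤ kstar → |S i k s| ≤ 2 * Λ₁ := by
        intro s hs i k hk
        have h := hxH s ⟨hs.1, hs.2.trans hx.2.le⟩ i k hk
        rwa [min_eq_left hs.2] at h
      -- improvement at `x`: within `Λ₁/2` of the start
      have himp : ∀ (i : Fin m) (k : ℤ), k ≤ kstar → |S i k x| ≤ 3 / 2 * Λ₁ := by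
        intro i k hk
        rcases eq_or_lt_of_le hx.1 with h0x | hxpos
        · rw [← h0x, hS.init_S]; linarith [h0 i k hk]
        · have hmove := hslope i k hk 0 x (2 * Λ₁) le_rfl hxpos hx.2.le (by linarith)
            (fun u hu j k' hk' => by
              rcases le_or_gt k' kstar with h | h
              · exact hist u ⟨hu.1.le, hu.2.le⟩ j k' h
              · have : k' = kstar + 1 := by omega
                subst this; exact hb j u ⟨hu.1.le, hu.2.le.trans hx.2.le⟩)
          rw [hS.init_S, sub_zero] at hmove
          have hx' : clockW ε₀ kstar * tableAbsSum 𝕊 α * (2 * Λ₁) ^ 2 * x ≤ Λ₁ / 2 := by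
            have : clockW ε₀ kstar * tableAbsSum 𝕊 α * (2 * Λ₁) ^ 2 * x ≤ clockW ε₀ kstar * tableAbsSum 𝕊 α * (2 * Λ₁) ^ 2 * τ :=
              mul_le_mul_of_nonneg_left hx.2.le (by have := (hc kstar).le; positivity)
            nlinarith [hc kstar]
          have := abs_sub_abs_le_abs_sub (S i k x) (S₀ i k)
          linarith [h0 i k hk]
      -- uniform Lipschitz step beyond `x`
      set L : ℝ := clockW ε₀ kstar * tableAbsSum 𝕊 α * M'' ^ 2 + 1 with hL
      have hL0 : 0 < L := by have := (hc kstar).le; positivity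
      set δ : ℝ := Λ₁ / (2 * L) with hδ
      have hδ0 : 0 < δ := by positivity
      rw [mem_nhdsGT_iff_exists_Ioo_subset]
      refine ⟨min τ (x + δ), lt_min hx.2 (by linarith), fun t ht => ?_⟩
      have htτ : t ≤ τ := (ht.2.trans_le (min_le_left _ _)).le
      have htδ : t < x + δ := ht.2.trans_le (min_le_right _ _)
      have hxt : x < t := ht.1
      have hext : ∀ s ∈ Icc 0 t, ∀ (i : Fin m) (k : ℤ), k ≤ kstar → |S i k s| ≤ 2 * Λ₁ := by
        intro s hs i k hk
        by_cases hsx : s ≤ x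
        · exact hist s ⟨hs.1, hsx⟩ i k hk
        · rw [not_le] at hsx
          have hmove := hslope i k hk x s M'' hx.1 hsx (hs.2.trans htτ) hM''0
            (fun u hu j k' _ => hMabs' u ⟨hx.1.trans hu.1.le, hu.2.le.trans (hs.2.trans htτ)⟩ j k')
          have hsmall' : clockW ε₀ kstar * tableAbsSum 𝕊 α * M'' ^ 2 * (s - x) ≤ Λ₁ / 2 := by
            have h1 : clockW ε₀ kstar * tableAbsSum 𝕊 α * M'' ^ 2 ≤ L := by rw [hL]; linarith
            have h2 : s - x ≤ δ := by linarith [hs.2]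
            calc clockW ε₀ kstar * tableAbsSum 𝕊 α * M'' ^ 2 * (s - x) ≤ L * δ :=
                  mul_le_mul h1 h2 (by linarith) hL0.le
              _ = Λ₁ / 2 := by rw [hδ]; field_simp
          have := abs_sub_abs_le_abs_sub (S i k s) (S i k x)
          linarith [himp i k hk]
      intro s hs i k hk
      have hm0 : 0 ≤ min s t := le_min hs.1 (hx.1.trans hxt.le)
      exact hext (min s t) ⟨hm0, min_le_right _ _⟩ i k hk
  intro i k hk t ht
  have h := hmain ht t ht i k hk
  rwa [min_self] at h

end Summit.NavierStokesRegularity.NavierStokesRegularity.Theorems.HopTube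

end
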